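import Literature.Geometry.Lorentzian.KerrSchildSymmHypReduction
import Literature.Analysis.PDE.SymmetricHyperbolicExistence
import HarnessLib

/-!
# The Cauchy problem for the wave equation on generalised Kerr–Schild backgrounds over `ℝ⁴`:
# the named fact `KerrSchild.waveCauchyProblem` is a theorem (family `gr`)

`KerrSchild.waveCauchyProblem_holds : KerrSchild.waveCauchyProblem` discharges the named fact of
`KerrSchildWaveCauchyProblem.lean` (the global Cauchy problem with domain of dependence for
`□_g u = 0`, `g = η + φ ℓ ⊗ ℓ` a generalised Kerr–Schild background on `ℝ⁴`, with coordinate Cauchy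
data `(ψ₀, ψ₁) ∈ C_c^∞ × C_c^∞` on `{t = 0}`; Bär–Ginoux–Pfäffle 2007, Thm. 3.2.11 in the global
Kerr–Schild chart, with Choquet-Bruhat–Cotsakis 2002, Thm. 2.1 for global hyperbolicity).

The proof is the classical one for linear wave equations with smooth coefficients of bounded
geometry, entirely inside the tree:

* `KerrSchild.waveCauchyProblem_of_symmHyperbolic` (`KerrSchildSymmHypReduction.lean`): John's
  reduction of `□_G u = 0` on a **tame** background to the symmetrised first-order system
  `∂_t W = 𝔄ᵏ ∂_k W + 𝔅 W` in Friedrichs' format (lapse–shift variables, the square root of the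
  slice metric; constraint propagation by characteristics; the component equations and the
  pointwise identity for `□_G`), the admissibility of its coefficients
  (`Literature.Analysis.PDE.IsSymmCoeffFamily`, joint smoothness, time-Lipschitz word derivatives)
  and the `C_c^∞` data, on top of `KerrSchild.waveCauchyProblem_of_slabSolutions`
  (`KerrSchildWaveCauchyAssembly.lean`: uniqueness by the energy method, gluing of slab solutions,
  domain of dependence, localisation of the coefficients to tame backgrounds);
* `Literature.Analysis.PDE.exists_smooth_solution` (`SymmetricHyperbolicExistence.lean`):
  Friedrichs' existence theorem for linear symmetric hyperbolic systems with regular admissible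
  coefficients and `C_c^∞` data — global smooth classical solutions (Friedrichs 1954; energy
  method with symmetric mollification, a-priori bounds of every order uniform in the
  regularisation scale, convergence in every Sobolev norm, Sobolev embedding).

Everything is proved; no named fact and no `sorry` is introduced.

## References

* C. Bär, N. Ginoux, F. Pfäffle, *Wave equations on Lorentzian manifolds and quantization*, EMS
  2007, Thm. 3.2.11. [BarGinouxPfaffle2007]
* Y. Choquet-Bruhat, S. Cotsakis, *Global hyperbolicity and completeness*, J. Geom. Phys. 43
  (2002) 345–350, Thm. 2.1. [ChoquetbruhatCotsakis2002]
* K. O. Friedrichs, *Symmetric hyperbolic linear differential equations*, Comm. Pure Appl. Math.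
  7 (1954) 345–392. [Friedrichs1954]
* F. John, *Partial differential equations*, 4th ed., Springer 1982, Ch. 5, §3. [John1982]
* S. Alinhac, *Hyperbolic Partial Differential Equations*, Springer 2009, §7.6, Thm. 7.11 and
  Example 7.5 (the wave equation as a symmetric system). [Alinhac2009]
-/

noncomputable section

open Set Filter Metric
open scoped ContDiff Topology

namespace Literature.Geometry.Lorentzian

namespace KerrSchild

open Literature.Analysis.PDE

/-- **The global Cauchy problem with domain of dependence for the wave equation on every
generalised Kerr–Schild background over `ℝ⁴` is solvable**: discharge of the named fact
`KerrSchild.waveCauchyProblem` (Bär–Ginoux–Pfäffle 2007, Thm. 3.2.11, in the global Kerr–Schild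
chart) by John's symmetric hyperbolic reduction and Friedrichs' existence theorem.
[cite: BarGinouxPfaffle2007, Thm. 3.2.11; ChoquetbruhatCotsakis2002, Thm. 2.1; Friedrichs1954, §§1–4; Alinhac2009, §7.6 Thm. 7.11, Ex. 7.5; John1982, Ch. 5 §3] -/
theorem waveCauchyProblem_holds : waveCauchyProblem :=
  waveCauchyProblem_of_symmHyperbolic fun A Bc hf hA hB hL U₀ hU₀ hc T _ ↦ by
    obtain ⟨U, h0, hs, -, hd⟩ :=
      exists_smooth_solution (A := A) (B := Bc) (U₀ := U₀) ⟨hf, hA, hB, hL⟩ hU₀ hc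
    exact ⟨U, h0, fun p _ ↦ hs.contDiffAt, fun t _ y ↦ hd t y⟩

end KerrSchild

end Literature.Geometry.Lorentzian

end
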